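import Summits.HubbardSuperconductivity.HubbardSuperconductivity.Theorems.CooperSharpnessTwistAveragingBoundDefs
import Literature.MathematicalPhysics.QuantumLattice.HubbardLSMFillingProofs
import Literature.MathematicalPhysics.QuantumLattice.ApproximateEigenvectorLemmas

/-!
# Route `CooperSharpness`, support `TwistAveragingBound` (item `stmt-HubbardSuperconductivity-12854`),
# part 1: the twisted `d`-wave pair field and the momentum sum of the twisted pair weights

With the vocabulary of `CooperSharpnessTwistAveragingBoundDefs` (`chargeTwist`, `upDown`, `downUp`,
`modeUpDown`, `modeDownUp`) and `T_k = fockTwist (chargeTwist L k)`: `T_k c_{y↑} T_k⁻¹ = conj χ_k(y) c_{y↑}`,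
`T_k c_{y↓} T_k⁻¹ = c_{y↓}`, hence `T_k Δ_g T_k⁻¹ = Σ_e (g e/√2) (F¹_e(k) − conj χ_k(e) F²_e(k))`
(`twist_pairField`), and Plancherel on `(ℤ/Lℤ)²` (`sum_conjTranspose_mul_fourierMode`) gives, for
`|g| ≤ 1` and every Fock vector `ψ`, `Σ_k ‖T_k Δ_g T_k⁻¹ ψ‖₂² ≤ 50 L⁴ ‖ψ‖₂²`
(`sum_eucNorm_twist_pairField_mulVec_sq_le`) — the pair-weight half of the twist average. All operator
norms are taken in vector form (`eucNorm`), generically in the orbital type, to stay clear of the two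
`DecidableEq` instances on the concrete torus.
Sources: Lieb–Schultz–Mattis, Ann. Phys. 16 (1961) 407, App. B; Oshikawa, PRL 84 (2000) 1535;
Kennedy–Lieb–Shastry, PRL 61 (1988) 2582; Scalapino, Phys. Rep. 250 (1995) 329, §2.
Finite-dimensional linear algebra throughout.
-/

set_option linter.dupNamespace false

noncomputable section

namespace Summit.HubbardSuperconductivity.HubbardSuperconductivity.Theorems.CooperSharpness

open Matrix Complex Literature.MathematicalPhysics.QuantumLattice
  Literature.Probability.LatticeModels
open scoped ComplexConjugate ComplexOrder Matrix.Norms.L2Operator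

variable {L : ℕ} [NeZero L]

/-! ### The charge twist angles -/

/-- The twist phase of an `↑` orbital is the conjugate torus character:
`exp(-i θ_k(y,↑)) = conj χ_k(y)`. [folklore] -/
theorem cexp_neg_chargeTwist_up (k : TorusSite 2 L) (y : FermionTorus 2 L) :
    cexp (-((chargeTwist L k (orb y 0) : ℂ) * I)) = conj (torusChar k (FermionTorus.toTorusSite y)) := by
  rw [chargeTwist_up, ← exp_neg_dotProduct_eq_conj_torusChar]
  congr 1
  push_cast
  ring

/-- **Twisting an `↑` annihilation operator**: `T_k c_{y↑} T_k⁻¹ = conj χ_k(y) c_{y↑}`.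
Lieb–Schultz–Mattis (1961), App. B. [folklore] -/
theorem twist_annihilation_up (k : TorusSite 2 L) (y : FermionTorus 2 L) :
    fockTwist (chargeTwist L k) * annihilation (orb y 0) * fockTwist (-chargeTwist L k) =
      conj (torusChar k (FermionTorus.toTorusSite y)) • annihilation (orb y 0) := by
  rw [fockTwist_mul_annihilation_mul, cexp_neg_chargeTwist_up]

/-- **Twisting a `↓` annihilation operator**: `T_k c_{y↓} T_k⁻¹ = c_{y↓}`. [folklore] -/
theorem twist_annihilation_down (k : TorusSite 2 L) (y : FermionTorus 2 L) :
    fockTwist (chargeTwist L k) * annihilation (orb y 1) * fockTwist (-chargeTwist L k) =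
      annihilation (orb y 1) := by
  rw [fockTwist_mul_annihilation_mul, chargeTwist_down]
  simp

/-! ### Bond pair annihilators and their Fourier modes -/

/-- Twisting the `↑↓` bond pair: `T_k (c_{x↑}c_{x+e,↓}) T_k⁻¹ = conj χ_k(x) c_{x↑}c_{x+e,↓}`. [folklore] -/
theorem twist_upDown (k : TorusSite 2 L) (e : Site 2) (x : TorusSite 2 L) :
    fockTwist (chargeTwist L k) * upDown L e x * fockTwist (-chargeTwist L k) =
      conj (torusChar k x) • upDown L e x := by
  rw [upDown, fockTwist_conj_mul, twist_annihilation_up, twist_annihilation_down,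
    FermionTorus.toTorusSite_ofTorusSite, Matrix.smul_mul]

/-- Twisting the `↓↑` bond pair:
`T_k (c_{x↓}c_{x+e,↑}) T_k⁻¹ = conj χ_k(x) conj χ_k(e) c_{x↓}c_{x+e,↑}`. [folklore] -/
theorem twist_downUp (k : TorusSite 2 L) (e : Site 2) (x : TorusSite 2 L) :
    fockTwist (chargeTwist L k) * downUp L e x * fockTwist (-chargeTwist L k) =
      (conj (torusChar k x) * conj (torusChar k (Torus.proj L e))) • downUp L e x := by
  rw [downUp, fockTwist_conj_mul, twist_annihilation_up, twist_annihilation_down,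
    FermionTorus.toTorusSite_ofTorusSite, Matrix.mul_smul, torusChar_add_right, map_mul]

/-- **The twisted pair field** is a combination of Fourier modes of the bond pair annihilators:
`T_k Δ_g T_k⁻¹ = Σ_e (g e/√2) (F¹_e(k) − conj χ_k(e) F²_e(k))`.
Lieb–Schultz–Mattis (1961) App. B; Kennedy–Lieb–Shastry (1988). [folklore] -/
theorem twist_pairField (g : Site 2 → ℝ) (k : TorusSite 2 L) :
    fockTwist (chargeTwist L k) * pairField g L * fockTwist (-chargeTwist L k) =
      ∑ e ∈ insert 0 unitSteps, ((g e / Real.sqrt 2 : ℝ) : ℂ) •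
        (modeUpDown L e k - conj (torusChar k (Torus.proj L e)) • modeDownUp L e k) := by
  have hx : ∀ x : TorusSite 2 L,
      fockTwist (chargeTwist L k) * localPair g L x * fockTwist (-chargeTwist L k) =
        ∑ e ∈ insert 0 unitSteps, ((g e / Real.sqrt 2 : ℝ) : ℂ) •
          (conj (torusChar k x) • upDown L e x -
            (conj (torusChar k x) * conj (torusChar k (Torus.proj L e))) • downUp L e x) := by
    intro x
    rw [localPair_eq_sum_upDown_sub_downUp, Finset.mul_sum, Finset.sum_mul]
    refine Finset.sum_congr rfl fun e _ => ?_
    rw [Matrix.mul_smul, Matrix.smul_mul, Matrix.mul_sub, Matrix.sub_mul, twist_upDown,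
      twist_downUp]
  unfold pairField
  rw [Finset.mul_sum, Finset.sum_mul]
  simp_rw [hx]
  rw [Finset.sum_comm]
  refine Finset.sum_congr rfl fun e _ => ?_
  rw [← Finset.smul_sum, Finset.sum_sub_distrib, modeUpDown, modeDownUp, Finset.smul_sum]
  congr 2
  refine Finset.sum_congr rfl fun x _ => ?_
  rw [smul_smul, mul_comm]


/-! ### Norm bookkeeping (vector form: no operator-norm instance at the concrete torus) -/

section Generic

variable {ι : Type*} [LinearOrder ι] [Fintype ι]

/-- `‖c_a c_b‖ ≤ 1` in operator norm (`‖c‖ ≤ 1`). Koma–Tasaki, PRL 68 (1992) 3248. [folklore] -/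
theorem norm_annihilation_mul_annihilation_le_one (a b : ι) :
    ‖(annihilation a * annihilation b : Matrix (Finset ι) (Finset ι) ℂ)‖ ≤ 1 :=
  (norm_mul_le _ _).trans
    (mul_le_one₀ (norm_annihilation_le_one _) (norm_nonneg _) (norm_annihilation_le_one _))

/-- `‖c_a c_b ψ‖₂ ≤ ‖ψ‖₂` for every Fock vector `ψ`. [folklore] -/
theorem eucNorm_annihilation_mul_annihilation_mulVec_le (a b : ι) (ψ : Fock ι) :
    eucNorm ((annihilation a * annihilation b) *ᵥ ψ) ≤ eucNorm ψ :=
  (eucNorm_mulVec_le _ _).trans (mul_le_of_le_one_left (eucNorm_nonneg _)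
    (norm_annihilation_mul_annihilation_le_one a b))

omit [LinearOrder ι] in
/-- The Euclidean norm is subadditive over finite sums. [folklore] -/
theorem eucNorm_sum_le {κ : Type*} (s : Finset κ) (v : κ → Fock ι) :
    eucNorm (∑ i ∈ s, v i) ≤ ∑ i ∈ s, eucNorm (v i) := by
  classical
  induction s using Finset.induction_on with
  | empty => simp
  | insert a s ha ih =>
    rw [Finset.sum_insert ha, Finset.sum_insert ha]
    exact (eucNorm_add_le _ _).trans (by linarith)

end Generic

/-- `‖c_{x↑} c_{x+e,↓} ψ‖₂ ≤ ‖ψ‖₂`. [folklore] -/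
theorem eucNorm_upDown_mulVec_le (e : Site 2) (x : TorusSite 2 L)
    (ψ : Fock (Orb (FermionTorus 2 L))) : eucNorm (upDown L e x *ᵥ ψ) ≤ eucNorm ψ :=
  eucNorm_annihilation_mul_annihilation_mulVec_le _ _ ψ

/-- `‖c_{x↓} c_{x+e,↑} ψ‖₂ ≤ ‖ψ‖₂`. [folklore] -/
theorem eucNorm_downUp_mulVec_le (e : Site 2) (x : TorusSite 2 L)
    (ψ : Fock (Orb (FermionTorus 2 L))) : eucNorm (downUp L e x *ᵥ ψ) ≤ eucNorm ψ :=
  eucNorm_annihilation_mul_annihilation_mulVec_le _ _ ψ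

/-- The torus `(ℤ/Lℤ)²` has `L²` momentum labels. [folklore] -/
theorem card_torusSite_two : Fintype.card (TorusSite 2 L) = L ^ 2 := by
  rw [Fintype.card_fun, ZMod.card, Fintype.card_fin]

/-! ### Plancherel bounds for the Fourier modes -/

/-- **Sum rule for the `↑↓` modes**: `Σ_k ‖F¹_e(k) ψ‖₂² = L² Σ_x ‖c_{x↑}c_{x+e,↓} ψ‖₂² ≤ L⁴ ‖ψ‖₂²`.
Kennedy–Lieb–Shastry, PRL 61 (1988) 2582 (Parseval). [cite: KLS1988PRL, p. 2582] -/
theorem sum_eucNorm_modeUpDown_sq_le (e : Site 2) (ψ : Fock (Orb (FermionTorus 2 L))) :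
    ∑ k, eucNorm (modeUpDown L e k *ᵥ ψ) ^ 2 ≤ (L : ℝ) ^ 4 * eucNorm ψ ^ 2 := by
  have h := congrArg (fun T => (star ψ ⬝ᵥ (T *ᵥ ψ)).re)
    (sum_conjTranspose_mul_fourierMode (d := 2) (L := L) (upDown L e))
  simp only [sum_mulVec, dotProduct_sum, smul_mulVec, dotProduct_smul, smul_eq_mul,
    Complex.re_sum] at h
  have hmode : ∀ k, (star ψ ⬝ᵥ ((∑ x, conj (torusChar k x) • upDown L e x)ᴴ *
      (∑ y, conj (torusChar k y) • upDown L e y)) *ᵥ ψ).re = eucNorm (modeUpDown L e k *ᵥ ψ) ^ 2 := by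
    intro k
    rw [← Literature.MathematicalPhysics.QuantumLattice.star_mulVec_dotProduct_mulVec, eucNorm_sq]
    rfl
  simp only [hmode] at h
  rw [h]
  have hL2 : ((L : ℂ) ^ 2 * ∑ x, star ψ ⬝ᵥ ((upDown L e x)ᴴ * upDown L e x) *ᵥ ψ).re =
      (L : ℝ) ^ 2 * ∑ x, eucNorm (upDown L e x *ᵥ ψ) ^ 2 := by
    rw [show ((L : ℂ) ^ 2) = (((L : ℝ) ^ 2 : ℝ) : ℂ) by push_cast; rfl, Complex.re_ofReal_mul,
      Complex.re_sum]
    congr 1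
    refine Finset.sum_congr rfl fun x _ => ?_
    rw [← Literature.MathematicalPhysics.QuantumLattice.star_mulVec_dotProduct_mulVec, eucNorm_sq]
  rw [hL2]
  have hx : ∀ x, eucNorm (upDown L e x *ᵥ ψ) ^ 2 ≤ eucNorm ψ ^ 2 := by
    intro x
    exact pow_le_pow_left₀ (eucNorm_nonneg _) (eucNorm_upDown_mulVec_le e x ψ) 2
  calc (L : ℝ) ^ 2 * ∑ x, eucNorm (upDown L e x *ᵥ ψ) ^ 2
      ≤ (L : ℝ) ^ 2 * ∑ _x : TorusSite 2 L, eucNorm ψ ^ 2 :=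
        mul_le_mul_of_nonneg_left (Finset.sum_le_sum fun x _ => hx x) (by positivity)
    _ = (L : ℝ) ^ 4 * eucNorm ψ ^ 2 := by
        rw [Finset.sum_const, Finset.card_univ, card_torusSite_two, nsmul_eq_mul]
        push_cast
        ring

/-- **Sum rule for the `↓↑` modes**: `Σ_k ‖F²_e(k) ψ‖₂² ≤ L⁴ ‖ψ‖₂²`.
Kennedy–Lieb–Shastry, PRL 61 (1988) 2582 (Parseval). [cite: KLS1988PRL, p. 2582] -/
theorem sum_eucNorm_modeDownUp_sq_le (e : Site 2) (ψ : Fock (Orb (FermionTorus 2 L))) :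
    ∑ k, eucNorm (modeDownUp L e k *ᵥ ψ) ^ 2 ≤ (L : ℝ) ^ 4 * eucNorm ψ ^ 2 := by
  have h := congrArg (fun T => (star ψ ⬝ᵥ (T *ᵥ ψ)).re)
    (sum_conjTranspose_mul_fourierMode (d := 2) (L := L) (downUp L e))
  simp only [sum_mulVec, dotProduct_sum, smul_mulVec, dotProduct_smul, smul_eq_mul,
    Complex.re_sum] at h
  have hmode : ∀ k, (star ψ ⬝ᵥ ((∑ x, conj (torusChar k x) • downUp L e x)ᴴ *
      (∑ y, conj (torusChar k y) • downUp L e y)) *ᵥ ψ).re = eucNorm (modeDownUp L e k *ᵥ ψ) ^ 2 := by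
    intro k
    rw [← Literature.MathematicalPhysics.QuantumLattice.star_mulVec_dotProduct_mulVec, eucNorm_sq]
    rfl
  simp only [hmode] at h
  rw [h]
  have hL2 : ((L : ℂ) ^ 2 * ∑ x, star ψ ⬝ᵥ ((downUp L e x)ᴴ * downUp L e x) *ᵥ ψ).re =
      (L : ℝ) ^ 2 * ∑ x, eucNorm (downUp L e x *ᵥ ψ) ^ 2 := by
    rw [show ((L : ℂ) ^ 2) = (((L : ℝ) ^ 2 : ℝ) : ℂ) by push_cast; rfl, Complex.re_ofReal_mul,
      Complex.re_sum]
    congr 1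
    refine Finset.sum_congr rfl fun x _ => ?_
    rw [← Literature.MathematicalPhysics.QuantumLattice.star_mulVec_dotProduct_mulVec, eucNorm_sq]
  rw [hL2]
  have hx : ∀ x, eucNorm (downUp L e x *ᵥ ψ) ^ 2 ≤ eucNorm ψ ^ 2 := by
    intro x
    exact pow_le_pow_left₀ (eucNorm_nonneg _) (eucNorm_downUp_mulVec_le e x ψ) 2
  calc (L : ℝ) ^ 2 * ∑ x, eucNorm (downUp L e x *ᵥ ψ) ^ 2
      ≤ (L : ℝ) ^ 2 * ∑ _x : TorusSite 2 L, eucNorm ψ ^ 2 :=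
        mul_le_mul_of_nonneg_left (Finset.sum_le_sum fun x _ => hx x) (by positivity)
    _ = (L : ℝ) ^ 4 * eucNorm ψ ^ 2 := by
        rw [Finset.sum_const, Finset.card_univ, card_torusSite_two, nsmul_eq_mul]
        push_cast
        ring


/-! ### The momentum sum of the twisted pair weights -/

/-- `{0, ±e₁, ±e₂}` has at most five elements. [folklore] -/
theorem card_insert_zero_unitSteps_le : (insert (0 : Site 2) unitSteps).card ≤ 5 := by
  unfold unitSteps
  refine (Finset.card_insert_le _ _).trans ?_
  refine Nat.succ_le_succ ((Finset.card_insert_le _ _).trans ?_)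
  refine Nat.succ_le_succ ((Finset.card_insert_le _ _).trans ?_)
  refine Nat.succ_le_succ ((Finset.card_insert_le _ _).trans ?_)
  rw [Finset.card_singleton]

/-- **Norm of the twisted pair field on a vector**: for a form factor with `|g| ≤ 1`,
`‖T_k Δ_g T_k⁻¹ ψ‖₂ ≤ (1/√2) Σ_e (‖F¹_e(k)ψ‖₂ + ‖F²_e(k)ψ‖₂)`. [folklore] -/
theorem eucNorm_twist_pairField_mulVec_le {g : Site 2 → ℝ} (hg : ∀ e, |g e| ≤ 1)
    (k : TorusSite 2 L) (ψ : Fock (Orb (FermionTorus 2 L))) :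
    eucNorm ((fockTwist (chargeTwist L k) * pairField g L * fockTwist (-chargeTwist L k)) *ᵥ ψ) ≤
      (1 / Real.sqrt 2) * ∑ e ∈ insert 0 unitSteps,
        (eucNorm (modeUpDown L e k *ᵥ ψ) + eucNorm (modeDownUp L e k *ᵥ ψ)) := by
  rw [twist_pairField, sum_mulVec, Finset.mul_sum]
  refine (eucNorm_sum_le _ _).trans (Finset.sum_le_sum fun e _ => ?_)
  rw [smul_mulVec, eucNorm_smul, sub_mulVec, smul_mulVec]
  have hc : ‖((g e / Real.sqrt 2 : ℝ) : ℂ)‖ ≤ 1 / Real.sqrt 2 := by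
    rw [Complex.norm_real, Real.norm_eq_abs, abs_div, abs_of_pos (Real.sqrt_pos.2 two_pos)]
    exact div_le_div_of_nonneg_right (hg e) (Real.sqrt_nonneg 2)
  have hsub : eucNorm (modeUpDown L e k *ᵥ ψ - conj (torusChar k (Torus.proj L e)) •
      (modeDownUp L e k *ᵥ ψ)) ≤ eucNorm (modeUpDown L e k *ᵥ ψ) + eucNorm (modeDownUp L e k *ᵥ ψ) := by
    refine (eucNorm_sub_le _ _).trans ?_
    rw [eucNorm_smul, RCLike.norm_conj, norm_torusChar, one_mul]
  have h0 : 0 ≤ eucNorm (modeUpDown L e k *ᵥ ψ) + eucNorm (modeDownUp L e k *ᵥ ψ) :=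
    add_nonneg (eucNorm_nonneg _) (eucNorm_nonneg _)
  exact mul_le_mul hc hsub (eucNorm_nonneg _) (by positivity)

/-- The square of the previous bound: `‖T_k Δ_g T_k⁻¹ ψ‖₂² ≤ 5 Σ_e (‖F¹_e(k)ψ‖₂² + ‖F²_e(k)ψ‖₂²)`
(Cauchy–Schwarz over the at most five steps). [folklore] -/
theorem eucNorm_twist_pairField_mulVec_sq_le {g : Site 2 → ℝ} (hg : ∀ e, |g e| ≤ 1)
    (k : TorusSite 2 L) (ψ : Fock (Orb (FermionTorus 2 L))) :
    eucNorm ((fockTwist (chargeTwist L k) * pairField g L * fockTwist (-chargeTwist L k)) *ᵥ ψ) ^ 2 ≤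
      5 * ∑ e ∈ insert 0 unitSteps,
        (eucNorm (modeUpDown L e k *ᵥ ψ) ^ 2 + eucNorm (modeDownUp L e k *ᵥ ψ) ^ 2) := by
  set S := insert (0 : Site 2) unitSteps with hS
  set u : Site 2 → ℝ := fun e => eucNorm (modeUpDown L e k *ᵥ ψ) + eucNorm (modeDownUp L e k *ᵥ ψ)
    with hu
  have h1 := eucNorm_twist_pairField_mulVec_le hg k ψ
  have hsum0 : 0 ≤ ∑ e ∈ S, u e :=
    Finset.sum_nonneg fun e _ => add_nonneg (eucNorm_nonneg _) (eucNorm_nonneg _)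
  have h2 : eucNorm ((fockTwist (chargeTwist L k) * pairField g L * fockTwist (-chargeTwist L k)) *ᵥ ψ) ^ 2 ≤
      (1 / Real.sqrt 2 * ∑ e ∈ S, u e) ^ 2 := pow_le_pow_left₀ (eucNorm_nonneg _) h1 2
  have h3 : (1 / Real.sqrt 2 * ∑ e ∈ S, u e) ^ 2 = (1 / 2) * (∑ e ∈ S, u e) ^ 2 := by
    rw [mul_pow, div_pow, one_pow, Real.sq_sqrt zero_le_two]
  have h4 : (∑ e ∈ S, u e) ^ 2 ≤ S.card * ∑ e ∈ S, u e ^ 2 := sq_sum_le_card_mul_sum_sq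
  have h5 : (S.card : ℝ) ≤ 5 := by exact_mod_cast card_insert_zero_unitSteps_le
  have h6 : ∀ e, u e ^ 2 ≤ 2 * (eucNorm (modeUpDown L e k *ᵥ ψ) ^ 2 + eucNorm (modeDownUp L e k *ᵥ ψ) ^ 2) := by
    intro e
    simp only [hu]
    nlinarith [sq_nonneg (eucNorm (modeUpDown L e k *ᵥ ψ) - eucNorm (modeDownUp L e k *ᵥ ψ))]
  have h7 : ∑ e ∈ S, u e ^ 2 ≤
      2 * ∑ e ∈ S, (eucNorm (modeUpDown L e k *ᵥ ψ) ^ 2 + eucNorm (modeDownUp L e k *ᵥ ψ) ^ 2) := by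
    rw [Finset.mul_sum]
    exact Finset.sum_le_sum fun e _ => h6 e
  have h8 : 0 ≤ ∑ e ∈ S, (eucNorm (modeUpDown L e k *ᵥ ψ) ^ 2 + eucNorm (modeDownUp L e k *ᵥ ψ) ^ 2) :=
    Finset.sum_nonneg fun e _ => by positivity
  have h9 : 0 ≤ ∑ e ∈ S, u e ^ 2 := Finset.sum_nonneg fun e _ => by positivity
  calc eucNorm ((fockTwist (chargeTwist L k) * pairField g L * fockTwist (-chargeTwist L k)) *ᵥ ψ) ^ 2
      ≤ (1 / 2) * (∑ e ∈ S, u e) ^ 2 := h2.trans h3.le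
    _ ≤ (1 / 2) * (S.card * ∑ e ∈ S, u e ^ 2) := by gcongr
    _ ≤ (1 / 2) * (5 * (2 * ∑ e ∈ S,
          (eucNorm (modeUpDown L e k *ᵥ ψ) ^ 2 + eucNorm (modeDownUp L e k *ᵥ ψ) ^ 2))) :=
        mul_le_mul_of_nonneg_left (mul_le_mul h5 h7 h9 (by norm_num)) (by norm_num)
    _ = 5 * ∑ e ∈ S, (eucNorm (modeUpDown L e k *ᵥ ψ) ^ 2 + eucNorm (modeDownUp L e k *ᵥ ψ) ^ 2) := by
        ring

/-- **Momentum sum of the twisted pair weights.** For every form factor with `|g| ≤ 1` and every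
Fock vector `ψ`, `Σ_{k ∈ (ℤ/Lℤ)²} ‖T_k Δ_g T_k⁻¹ ψ‖₂² ≤ 50 L⁴ ‖ψ‖₂²` (Plancherel for the bond pair
modes). Kennedy–Lieb–Shastry, PRL 61 (1988) 2582 (Parseval sum rule). [cite: KLS1988PRL, p. 2582] -/
theorem sum_eucNorm_twist_pairField_mulVec_sq_le {g : Site 2 → ℝ} (hg : ∀ e, |g e| ≤ 1)
    (ψ : Fock (Orb (FermionTorus 2 L))) :
    ∑ k, eucNorm ((fockTwist (chargeTwist L k) * pairField g L *
        fockTwist (-chargeTwist L k)) *ᵥ ψ) ^ 2 ≤ 50 * (L : ℝ) ^ 4 * eucNorm ψ ^ 2 := by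
  set S := insert (0 : Site 2) unitSteps with hS
  have h1 : ∑ k, eucNorm ((fockTwist (chargeTwist L k) * pairField g L *
        fockTwist (-chargeTwist L k)) *ᵥ ψ) ^ 2 ≤
      ∑ k, 5 * ∑ e ∈ S, (eucNorm (modeUpDown L e k *ᵥ ψ) ^ 2 + eucNorm (modeDownUp L e k *ᵥ ψ) ^ 2) :=
    Finset.sum_le_sum fun k _ => eucNorm_twist_pairField_mulVec_sq_le hg k ψ
  refine h1.trans ?_
  rw [← Finset.mul_sum, Finset.sum_comm]
  have h2 : ∀ e ∈ S, ∑ k, (eucNorm (modeUpDown L e k *ᵥ ψ) ^ 2 + eucNorm (modeDownUp L e k *ᵥ ψ) ^ 2) ≤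
      2 * ((L : ℝ) ^ 4 * eucNorm ψ ^ 2) := by
    intro e _
    have ha := sum_eucNorm_modeUpDown_sq_le e ψ
    have hb := sum_eucNorm_modeDownUp_sq_le e ψ
    rw [Finset.sum_add_distrib]
    linarith
  have h3 : ∑ e ∈ S, ∑ k, (eucNorm (modeUpDown L e k *ᵥ ψ) ^ 2 + eucNorm (modeDownUp L e k *ᵥ ψ) ^ 2) ≤
      S.card * (2 * ((L : ℝ) ^ 4 * eucNorm ψ ^ 2)) := by
    refine (Finset.sum_le_sum h2).trans ?_
    rw [Finset.sum_const, nsmul_eq_mul]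
  have h5 : (S.card : ℝ) ≤ 5 := by exact_mod_cast card_insert_zero_unitSteps_le
  have h6 : 0 ≤ (L : ℝ) ^ 4 * eucNorm ψ ^ 2 := by positivity
  calc 5 * ∑ e ∈ S, ∑ k, (eucNorm (modeUpDown L e k *ᵥ ψ) ^ 2 + eucNorm (modeDownUp L e k *ᵥ ψ) ^ 2)
      ≤ 5 * (S.card * (2 * ((L : ℝ) ^ 4 * eucNorm ψ ^ 2))) := by gcongr
    _ ≤ 5 * (5 * (2 * ((L : ℝ) ^ 4 * eucNorm ψ ^ 2))) := by gcongr
    _ = 50 * (L : ℝ) ^ 4 * eucNorm ψ ^ 2 := by ring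

end Summit.HubbardSuperconductivity.HubbardSuperconductivity.Theorems.CooperSharpness
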